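import Summits.AtomisticToContinuum.Crystallization.Theorems.ChargedEnergyGapTwinWallsLinkA

/-!
# «TwinWalls» link (lens-3 g59 P-G(2/2), line 14231) — part B (sequel of `…ChargedEnergyGapTwinWallsLinkA`)

Split for the 400-line cap by the landing lane (hand-2 g29); the module docstring of part A describes the whole node.  Same namespace; all FQNs unchanged.
0 sorry; standard axioms.
-/

noncomputable section
open Literature.MathematicalPhysics.StatisticalMechanics
open Literature.Geometry.DiscreteGeometry
open Summit.AtomisticToContinuum.Crystallization.Theses.PricedLinkCensus
open Summit.AtomisticToContinuum.Crystallization.Theorems.ChargedEnergyGapNegative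

namespace Summit.AtomisticToContinuum.Crystallization.Theorems.ChargedEnergyGapChartDial

section TwinWallsLink


/-! ## D. The three pieces, proved for `θ ≤ 19/100` -/

/-- ★★ X-D0 PROVED. -/
theorem linkIsomorphism_of_le {θ : ℝ} (hθ : θ ≤ 19 / 100) : LinkIsomorphism θ := by
  intro Q p P hPP A T hT e he hp q r hq hr
  obtain ⟨S, N, hP, hM⟩ : ∃ (S : Finset (Fin 3 → ℤ)) (N : ℕ), P = scaledPattern S N ∧ ModelFacts S N := by
    rcases hPP with rfl | rfl
    · exact ⟨fccInt, 2, rfl, modelFacts_fcc⟩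
    · exact ⟨hcpInt, 18, rfl, modelFacts_hcp⟩
  obtain ⟨wq, hwqS, hwq⟩ := exists_label hP (e ⟨_, hq⟩)
  obtain ⟨wr, hwrS, hwr⟩ := exists_label hP (e ⟨_, hr⟩)
  rw [hwq, hwr, dist_frame_scaled_eq_one_iff A hM.1]
  exact ⟨touchInt_of_adj hM hT he hp hθ hq hr hwqS hwq hwrS hwr,
    adj_of_touchInt hP hM hT he hp hθ hq hr hwqS hwq hwrS hwr⟩

/-- ★★ X-D2 PROVED: no cis bond at an fcc-framed clean site. -/
theorem fccNoCis_of_le {θ : ℝ} (hθ : θ ≤ 19 / 100) : FccNoCis θ := by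
  intro Q p q A hp hA hcis
  obtain ⟨T, hT, e, he⟩ := hA
  have hP : fccKissingPattern = scaledPattern fccInt 2 := rfl
  obtain ⟨hpq, a, ha, b, hb, c, hc, hbc, hab, hac⟩ := hcis
  have hq : shellCoord Q p q ∈ T := (mem_shell_iff hT hp).2 hpq
  have haT : shellCoord Q p a ∈ T := (mem_shell_iff hT hp).2 ha.1
  have hbT : shellCoord Q p b ∈ T := (mem_shell_iff hT hp).2 hb.1
  have hcT : shellCoord Q p c ∈ T := (mem_shell_iff hT hp).2 hc.1
  obtain ⟨wq, hwqS, hwq⟩ := exists_label hP (e ⟨_, hq⟩)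
  obtain ⟨wa, hwaS, hwa⟩ := exists_label hP (e ⟨_, haT⟩)
  obtain ⟨wb, hwbS, hwb⟩ := exists_label hP (e ⟨_, hbT⟩)
  obtain ⟨wc, hwcS, hwc⟩ := exists_label hP (e ⟨_, hcT⟩)
  have hM := modelFacts_fcc
  have tqa := touchInt_of_adj hM hT he hp hθ hq haT hwqS hwq hwaS hwa ha.2
  have tqb := touchInt_of_adj hM hT he hp hθ hq hbT hwqS hwq hwbS hwb hb.2
  have tqc := touchInt_of_adj hM hT he hp hθ hq hcT hwqS hwq hwcS hwc hc.2
  have tab := touchInt_of_adj hM hT he hp hθ haT hbT hwaS hwa hwbS hwb hab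
  have tac := touchInt_of_adj hM hT he hp hθ haT hcT hwaS hwa hwcS hwc hac
  have hne : wb ≠ wc := fun h => hbc (eq_of_label_eq hbT hcT hwb hwc h)
  exact not_cisInt_fcc wq hwqS ⟨wa, Finset.mem_filter.2 ⟨hwaS, tqa⟩, wb, Finset.mem_filter.2 ⟨hwbS, tqb⟩, wc,
    Finset.mem_filter.2 ⟨hwcS, tqc⟩, hne, tab, tac⟩

/-- ★★ X-D1 PROVED: at a clean hcp-framed site the equatorial slots are exactly the cis bonds. -/
theorem slotDictionary_of_le {θ : ℝ} (hθ : θ ≤ 19 / 100) : SlotDictionary θ := by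
  intro Q p q A hp hA
  obtain ⟨T, hT, e, he⟩ := hA
  have hP : hcpKissingPattern = scaledPattern hcpInt 18 := rfl
  have hM := modelFacts_hcp
  constructor
  · rintro ⟨v, hv, hvq⟩
    obtain ⟨u, hu, rfl⟩ := Finset.mem_image.1 hv
    have huS : u ∈ hcpInt := hcpEquatorInt_subset hu
    have hFu : A ((Real.sqrt (18 : ℕ))⁻¹ • intVec u) ∈ hcpKissingPattern.image A := frameVec_mem hP huS
    have hAv : ‖A ((Real.sqrt (18 : ℕ))⁻¹ • intVec u)‖ = 1 := by
      rw [A.norm_map]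
      exact norm_eq_one_of_mem_hcpKissingPattern (Finset.mem_image_of_mem _ huS)
    -- `q` is a bond neighbour of `p`
    have hc : 0 < nn Q p := Blocks.nearestDist_pt_pos Q p
    have hn1 : ‖shellCoord Q p q‖ ≤ 1 + θ := by
      have := norm_le_norm_add_norm_sub' (shellCoord Q p q) (A ((Real.sqrt (18 : ℕ))⁻¹ • intVec u))
      rw [hAv, ← dist_eq_norm] at this
      linarith
    have hn2 : 1 - θ ≤ ‖shellCoord Q p q‖ := by
      have := norm_sub_norm_le (A ((Real.sqrt (18 : ℕ))⁻¹ • intVec u)) (shellCoord Q p q)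
      rw [hAv, ← dist_eq_norm, dist_comm] at this
      linarith
    have hqp : q ≠ p := by
      intro h
      subst h
      have h0 : shellCoord Q q q = 0 := by simp [shellCoord]
      rw [h0, norm_zero] at hn2
      linarith
    have hqd : dist (p : E3) q ≤ 6 / 5 * nn Q p := by
      rw [dist_eq_nn_mul_norm_shellCoord]
      nlinarith
    have hpq : (bonds Q).Adj p q := gappedAt_of_chartedAt Q hp.1 hp.2 q hqp hqd
    have hq : shellCoord Q p q ∈ T := (mem_shell_iff hT hp).2 hpq
    -- its label IS the slot vector
    have hmatch : (e ⟨_, hq⟩ : E3) = A ((Real.sqrt (18 : ℕ))⁻¹ • intVec u) := by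
      by_contra hne
      have h1 : dist (shellCoord Q p q) (e ⟨_, hq⟩ : E3) ≤ θ := he ⟨_, hq⟩
      have hy : ((e ⟨_, hq⟩ : ↥(hcpKissingPattern.image A)) : E3) ∈ hcpKissingPattern.image A := (e ⟨_, hq⟩).2
      obtain ⟨y0, hy0, hy0e⟩ := Finset.mem_image.1 hy
      have hge : 1 ≤ dist (e ⟨_, hq⟩ : E3) (A ((Real.sqrt (18 : ℕ))⁻¹ • intVec u)) := by
        rw [← hy0e, dist_frame]
        exact one_le_dist_of_mem_hcpKissingPattern hy0 (Finset.mem_image_of_mem _ huS)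
          (fun h => hne (by rw [← hy0e, h]))
      have hle : dist (e ⟨_, hq⟩ : E3) (A ((Real.sqrt (18 : ℕ))⁻¹ • intVec u)) ≤ θ + θ :=
        (dist_triangle _ (shellCoord Q p q) _).trans (by rw [dist_comm] at h1; linarith)
      linarith
    -- the model cherry at `u`, transported back into the ring of `p q`
    obtain ⟨a', ha', b', hb', c', hc', hbc', hab', hac'⟩ := (cisInt_hcp_iff u huS).2 hu
    obtain ⟨ha'S, hta⟩ := Finset.mem_filter.1 ha'
    obtain ⟨hb'S, htb⟩ := Finset.mem_filter.1 hb'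
    obtain ⟨hc'S, htc⟩ := Finset.mem_filter.1 hc'
    obtain ⟨qa, hpqa, hqa⟩ := exists_adj_of_mem_shell hT hp (e.symm ⟨_, frameVec_mem hP ha'S⟩).2
    obtain ⟨qb, hpqb, hqb⟩ := exists_adj_of_mem_shell hT hp (e.symm ⟨_, frameVec_mem hP hb'S⟩).2
    obtain ⟨qc, hpqc, hqc⟩ := exists_adj_of_mem_shell hT hp (e.symm ⟨_, frameVec_mem hP hc'S⟩).2
    have hqaT : shellCoord Q p qa ∈ T := (mem_shell_iff hT hp).2 hpqa
    have hqbT : shellCoord Q p qb ∈ T := (mem_shell_iff hT hp).2 hpqb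
    have hqcT : shellCoord Q p qc ∈ T := (mem_shell_iff hT hp).2 hpqc
    have hla : (e ⟨_, hqaT⟩ : E3) = A ((Real.sqrt (18 : ℕ))⁻¹ • intVec a') := by
      have h1 : (⟨shellCoord Q p qa, hqaT⟩ : ↥T) = e.symm ⟨_, frameVec_mem hP ha'S⟩ := Subtype.ext hqa
      rw [h1, Equiv.apply_symm_apply]
    have hlb : (e ⟨_, hqbT⟩ : E3) = A ((Real.sqrt (18 : ℕ))⁻¹ • intVec b') := by
      have h1 : (⟨shellCoord Q p qb, hqbT⟩ : ↥T) = e.symm ⟨_, frameVec_mem hP hb'S⟩ := Subtype.ext hqb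
      rw [h1, Equiv.apply_symm_apply]
    have hlc : (e ⟨_, hqcT⟩ : E3) = A ((Real.sqrt (18 : ℕ))⁻¹ • intVec c') := by
      have h1 : (⟨shellCoord Q p qc, hqcT⟩ : ↥T) = e.symm ⟨_, frameVec_mem hP hc'S⟩ := Subtype.ext hqc
      rw [h1, Equiv.apply_symm_apply]
    refine ⟨hpq, qa, ⟨hpqa, ?_⟩, qb, ⟨hpqb, ?_⟩, qc, ⟨hpqc, ?_⟩, ?_, ?_, ?_⟩
    · exact adj_of_touchInt hP hM hT he hp hθ hq hqaT huS hmatch ha'S hla hta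
    · exact adj_of_touchInt hP hM hT he hp hθ hq hqbT huS hmatch hb'S hlb htb
    · exact adj_of_touchInt hP hM hT he hp hθ hq hqcT huS hmatch hc'S hlc htc
    · intro h
      subst h
      exact hbc' (scaledPattern_map_injective (by norm_num) (A.injective (hlb.symm.trans hlc)))
    · exact adj_of_touchInt hP hM hT he hp hθ hqaT hqbT ha'S hla hb'S hlb hab'
    · exact adj_of_touchInt hP hM hT he hp hθ hqaT hqcT ha'S hla hc'S hlc hac'
  · rintro ⟨hpq, a, ha, b, hb, c, hc, hbc, hab, hac⟩
    have hq : shellCoord Q p q ∈ T := (mem_shell_iff hT hp).2 hpq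
    have haT : shellCoord Q p a ∈ T := (mem_shell_iff hT hp).2 ha.1
    have hbT : shellCoord Q p b ∈ T := (mem_shell_iff hT hp).2 hb.1
    have hcT : shellCoord Q p c ∈ T := (mem_shell_iff hT hp).2 hc.1
    obtain ⟨wq, hwqS, hwq⟩ := exists_label hP (e ⟨_, hq⟩)
    obtain ⟨wa, hwaS, hwa⟩ := exists_label hP (e ⟨_, haT⟩)
    obtain ⟨wb, hwbS, hwb⟩ := exists_label hP (e ⟨_, hbT⟩)
    obtain ⟨wc, hwcS, hwc⟩ := exists_label hP (e ⟨_, hcT⟩)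
    have tqa := touchInt_of_adj hM hT he hp hθ hq haT hwqS hwq hwaS hwa ha.2
    have tqb := touchInt_of_adj hM hT he hp hθ hq hbT hwqS hwq hwbS hwb hb.2
    have tqc := touchInt_of_adj hM hT he hp hθ hq hcT hwqS hwq hwcS hwc hc.2
    have tab := touchInt_of_adj hM hT he hp hθ haT hbT hwaS hwa hwbS hwb hab
    have tac := touchInt_of_adj hM hT he hp hθ haT hcT hwaS hwa hwcS hwc hac
    have hne : wb ≠ wc := fun h => hbc (eq_of_label_eq hbT hcT hwb hwc h)
    have hcisInt : CisInt hcpInt 18 wq := ⟨wa, Finset.mem_filter.2 ⟨hwaS, tqa⟩, wb, Finset.mem_filter.2 ⟨hwbS, tqb⟩,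
      wc, Finset.mem_filter.2 ⟨hwcS, tqc⟩, hne, tab, tac⟩
    have hequ : wq ∈ hcpEquatorInt := (cisInt_hcp_iff wq hwqS).1 hcisInt
    refine ⟨(Real.sqrt (18 : ℕ))⁻¹ • intVec wq, Finset.mem_image_of_mem _ hequ, ?_⟩
    rw [← hwq]
    exact he ⟨_, hq⟩

/-- ★★★ THE RECORD DICTIONARY IS A THEOREM. -/
theorem cleanLinkDictionaryRec_holds : CleanLinkDictionaryRec :=
  ⟨slotDictionary_of_le (by norm_num), fccNoCis_of_le (by norm_num)⟩

/-! ## E. The laws, unconditionally (`θ ≤ 19/100`; record `θ = 3/20`)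

The five laws (LC), (E3), (FU), (TE), (JX) are proved as `private` lemmas `…_of_le` (the gate's dedup
normaliser identifies their public versions with the conditional §5 laws of `…ChargedEnergyGapTwinWalls`,
critic row 1111 (2)); the PUBLIC record is the single conjunction `twinWallLaws_of_le` below, plus the
`θ = 3/20` specialisations. -/

section unconditional

variable {θ : ℝ} (hθ : θ ≤ 19 / 100)
include hθ

/-- ★★ (LC) LAYER CONTINUATION, unconditional. -/
private theorem equatorial_symm_of_le {Q : PeriodicConfiguration 3} {p q : Q.points} (hp : CleanAt Q θ p) (hq : CleanAt Q θ q)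
    (h : Equatorial Q θ p q) : Equatorial Q θ q p :=
  equatorial_symm (slotDictionary_of_le hθ) (fccNoCis_of_le hθ) hp hq h

/-- ★ (E3) WALLS END ONLY AT UNCLEAN SITES, unconditional. -/
private theorem not_cleanAt_of_wall_end_of_le {Q : PeriodicConfiguration 3} {p q : Q.points} (hp : CleanAt Q θ p)
    (h : Equatorial Q θ p q) (hend : ¬ Equatorial Q θ q p) : ¬ CleanAt Q θ q :=
  not_cleanAt_of_wall_end (slotDictionary_of_le hθ) (fccNoCis_of_le hθ) hp h hend

/-- ★ (FU) ONE LAYER PER SITE, unconditional. -/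
private theorem inSlot_of_inSlot_of_le {Q : PeriodicConfiguration 3} {p q : Q.points} {A A' : E3 →ₗᵢ[ℝ] E3}
    (hp : CleanAt Q θ p) (hA : HcpFrame Q θ p A) (hA' : HcpFrame Q θ p A') (h : InSlot Q θ p q A) :
    InSlot Q θ p q A' :=
  inSlot_of_inSlot (slotDictionary_of_le hθ) hp hA hA' h

/-- ★ (TE) TYPE EXCLUSIVE, unconditional. -/
private theorem not_fccFrame_of_hcpFrame_of_le {Q : PeriodicConfiguration 3} {p : Q.points} {A A' : E3 →ₗᵢ[ℝ] E3}
    (hp : CleanAt Q θ p) (hA : HcpFrame Q θ p A) : ¬ FccFrame Q θ p A' :=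
  not_fccFrame_of_hcpFrame (slotDictionary_of_le hθ) (fccNoCis_of_le hθ) hp hA

/-- ★★ (JX) JUNCTION EXCLUSION AT AN INSPECTED COLUMN, unconditional. -/
private theorem walls_through_clean_site_of_le {Q : PeriodicConfiguration 3} {c q₁ q₂ : Q.points} (hc : CleanAt Q θ c)
    (hq₁ : CleanAt Q θ q₁) (hq₂ : CleanAt Q θ q₂) (h₁ : Equatorial Q θ q₁ c) (h₂ : Equatorial Q θ q₂ c)
    {A : E3 →ₗᵢ[ℝ] E3} (hA : HcpFrame Q θ c A) : InSlot Q θ c q₁ A ∧ InSlot Q θ c q₂ A :=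
  walls_through_clean_site (slotDictionary_of_le hθ) (fccNoCis_of_le hθ) hc hq₁ hq₂ h₁ h₂ hA

/-- ★ The wall relation is symmetric, unconditional. -/
theorem wallAdj_symm_of_le {Q : PeriodicConfiguration 3} {p q : Q.points} (h : WallAdj θ Q p q) : WallAdj θ Q q p :=
  wallAdj_symm (slotDictionary_of_le hθ) (fccNoCis_of_le hθ) h

end unconditional

/-- ★★★ RECORD (critic row 1111 (2)): for every `θ ≤ 19/100` the five wall laws hold UNCONDITIONALLY —
(LC) layer continuation `Equatorial p q → Equatorial q p` between clean sites; (E3) walls end only at unclean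
sites; (FU) one layer per site (slot membership is frame-independent); (TE) type exclusivity (an hcp-framed clean
site is not fcc-framed); (JX) junction exclusion at an inspected column.  One public conjunction; project with
`.1`, `.2.1`, `.2.2.1`, `.2.2.2.1`, `.2.2.2.2`. -/
theorem twinWallLaws_of_le {θ : ℝ} (hθ : θ ≤ 19 / 100) :
    (∀ ⦃Q : PeriodicConfiguration 3⦄ ⦃p q : Q.points⦄, CleanAt Q θ p → CleanAt Q θ q →
        Equatorial Q θ p q → Equatorial Q θ q p) ∧
    (∀ ⦃Q : PeriodicConfiguration 3⦄ ⦃p q : Q.points⦄, CleanAt Q θ p →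
        Equatorial Q θ p q → ¬ Equatorial Q θ q p → ¬ CleanAt Q θ q) ∧
    (∀ ⦃Q : PeriodicConfiguration 3⦄ ⦃p q : Q.points⦄ ⦃A A' : E3 →ₗᵢ[ℝ] E3⦄, CleanAt Q θ p →
        HcpFrame Q θ p A → HcpFrame Q θ p A' → InSlot Q θ p q A → InSlot Q θ p q A') ∧
    (∀ ⦃Q : PeriodicConfiguration 3⦄ ⦃p : Q.points⦄ ⦃A A' : E3 →ₗᵢ[ℝ] E3⦄, CleanAt Q θ p →
        HcpFrame Q θ p A → ¬ FccFrame Q θ p A') ∧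
    (∀ ⦃Q : PeriodicConfiguration 3⦄ ⦃c q₁ q₂ : Q.points⦄ ⦃A : E3 →ₗᵢ[ℝ] E3⦄, CleanAt Q θ c →
        CleanAt Q θ q₁ → CleanAt Q θ q₂ → Equatorial Q θ q₁ c → Equatorial Q θ q₂ c →
        HcpFrame Q θ c A → InSlot Q θ c q₁ A ∧ InSlot Q θ c q₂ A) :=
  ⟨fun _ _ _ hp hq h => equatorial_symm_of_le hθ hp hq h,
    fun _ _ _ hp h hend => not_cleanAt_of_wall_end_of_le hθ hp h hend,
    fun _ _ _ _ _ hp hA hA' h => inSlot_of_inSlot_of_le hθ hp hA hA' h,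
    fun _ _ _ A' hp hA => not_fccFrame_of_hcpFrame_of_le (A' := A') hθ hp hA,
    fun _ _ _ _ _ hc hq₁ hq₂ h₁ h₂ hA => walls_through_clean_site_of_le hθ hc hq₁ hq₂ h₁ h₂ hA⟩

/-- (LC) at the record `θ = 3/20`. -/
theorem equatorial_symm_rec' {Q : PeriodicConfiguration 3} {p q : Q.points} (hp : CleanAt Q (3 / 20) p)
    (hq : CleanAt Q (3 / 20) q) (h : Equatorial Q (3 / 20) p q) : Equatorial Q (3 / 20) q p :=
  equatorial_symm_of_le (by norm_num) hp hq h

/-- (JX) at the record `θ = 3/20`. -/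
theorem walls_through_clean_site_rec' {Q : PeriodicConfiguration 3} {c q₁ q₂ : Q.points}
    (hc : CleanAt Q (3 / 20) c) (hq₁ : CleanAt Q (3 / 20) q₁) (hq₂ : CleanAt Q (3 / 20) q₂)
    (h₁ : Equatorial Q (3 / 20) q₁ c) (h₂ : Equatorial Q (3 / 20) q₂ c) {A : E3 →ₗᵢ[ℝ] E3}
    (hA : HcpFrame Q (3 / 20) c A) : InSlot Q (3 / 20) c q₁ A ∧ InSlot Q (3 / 20) c q₂ A :=
  walls_through_clean_site_of_le (by norm_num) hc hq₁ hq₂ h₁ h₂ hA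

/-- (E3) at the record `θ = 3/20`: a wall rim site is charged or uncharted. -/
theorem charged_or_uncharted_of_wall_end_rec {Q : PeriodicConfiguration 3} {p q : Q.points}
    (hp : CleanAt Q (3 / 20) p) (h : Equatorial Q (3 / 20) p q) (hend : ¬ Equatorial Q (3 / 20) q p) :
    ¬ IsChargeFree (1 / 100) (Subtype.val : Q.points → E3) q ∨ ¬ ChartedAt (3 / 20) Q q :=
  charged_or_uncharted_of_wall_end (slotDictionary_of_le (by norm_num)) (fccNoCis_of_le (by norm_num)) hp h hend

end TwinWallsLink

end Summit.AtomisticToContinuum.Crystallization.Theorems.ChargedEnergyGapChartDial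

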